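import Mathlib
import Summits.KontsevichZagierPeriods.KontsevichZagierPeriods.Theorems.SymplecticScissorsVolumeFormOffPlaneUnionSplit

/-!
# `VolumeFormOffPlane` (stmt-KontsevichZagierPeriods-14935) — line `Sketch`,
stub `stub_indicatorInclusionExclusion` (inclusion–exclusion for indicator functions)

Generic inclusion–exclusion principle for the real-valued indicator function of a finite union
`⋃ i, A i` of sets `A : Fin k → Set X`: pointwise,
`𝟙[⋃ i, A i] = ∑_{∅ ≠ S ⊆ Fin k} (-1) ^ (|S| + 1) · 𝟙[⋂ i ∈ S, A i]`,
written as a sum over all `S : Finset (Fin k)` with the empty set weighted by `0`.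

This is the specialisation to `s = Finset.univ`, `G = ℝ`, `f = 1` of Mathlib's
`Finset.indicator_biUnion_eq_sum_powerset`
(`Mathlib/Combinatorics/Enumerative/InclusionExclusion.lean`), with the `ℤ`-scalar action
rewritten as real multiplication. It is consumed by the neighbouring stub `stub_boxUnionPairs`
(overlapping finite unions of `Λ`-boxes) of the same line.

Sources: folklore (inclusion–exclusion principle).
-/

noncomputable section

open MeasureTheory Set
open Literature.NumberTheory.Transcendental

namespace Summit.KontsevichZagierPeriods.SymplecticScissors.LogPolytope

/-- **Inclusion–exclusion for indicator functions.** For finitely many sets `A i` (`i : Fin k`)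
and any point `x`, the indicator of `⋃ i, A i` at `x` is the alternating sum over the non-empty
`S : Finset (Fin k)` of `(-1) ^ (|S| + 1)` times the indicator of `⋂ i ∈ S, A i` at `x` (the
empty `S` carrying weight `0`). [folklore] -/
theorem stub_indicatorInclusionExclusion : ∀ (X : Type) (k : ℕ) (A : Fin k → Set X) (x : X),
    (⋃ i, A i).indicator (fun _ => (1 : ℝ)) x =
      ∑ S : Finset (Fin k), (if S.Nonempty then (-1 : ℝ) ^ (S.card + 1) else 0) *
        (⋂ i ∈ S, A i).indicator (fun _ => (1 : ℝ)) x := by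
  intro X k A x
  have h := Finset.indicator_biUnion_eq_sum_powerset (Finset.univ : Finset (Fin k)) A
    (fun _ => (1 : ℝ)) x
  have hU : (⋃ i ∈ (Finset.univ : Finset (Fin k)), A i) = ⋃ i, A i := by simp
  rw [hU, Finset.powerset_univ, Finset.sum_filter] at h
  rw [h]
  refine Finset.sum_congr rfl fun S _ => ?_
  split_ifs
  · rw [zsmul_eq_mul, Int.cast_pow, Int.cast_neg, Int.cast_one]
  · rw [zero_mul]

end Summit.KontsevichZagierPeriods.SymplecticScissors.LogPolytope

end
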